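import Literature.Probability.RandomPlanarGeometry.HullRestrictionSLE
import Literature.Probability.RandomPlanarGeometry.SLEExistenceConverse
import Literature.Probability.RandomPlanarGeometry.CritPercSLESimplePathProofs
import Literature.Probability.RandomPlanarGeometry.SimpleCurves
import Literature.Probability.RandomPlanarGeometry.CaratheodoryHalfPlaneProofs
import Summits.CriticalPhenomena.SAWScalingLimit.Theorems.SAWRenewalTightnessSubseqIdentificationSleRestrictionConsistency
import HarnessLib

/-!
# Transport of the SLE-side restriction identity to the half-plane (line `boundary-area-law`, RS5 helper)

Line `boundary-area-law` of the crux `SubseqIdentification` (stmt-CriticalPhenomena-0783, route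
`SAWRenewalTightness`; primary decl `SAWParafermion.SubseqIdentification`), restriction reshape
(lead c4): third helper file for the SLE-side stub RS5 `stub_sleRestrictionRigidity`. RS5 must
REFUTE, for `0 < κ ≤ 4`, `κ ≠ 8/3`, the identity

  `(∗)  μ'(T) · μ(N_r) = μ(T ∩ N_r)` for all Borel `T`,  `N_r = {c | r ≤ dist(x₀, trace c)}`,

(`μ`, `μ'` the chordal SLE_κ laws of a flat-window Dobrushin domain `(D; a, b)` and of the carved
domain `D' = D ∖ B̄(x₀, r)`). Its proof lives in the half-plane ([LSW] §5–§6: the compensated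
martingale `h_t'(W_t)^α exp(λ ∫ Sh_s(W_s)/6 ds)`); this file performs, for EVERY `0 < κ ≤ 4`, the
bookkeeping that turns `(∗)` into a statement about the SLE_κ trace `γ = sleTrace κ ω` on the
canonical space and the pulled-back hull `A = cl(ℍ ∖ φ⁻¹ D') ∈ 𝒬*` of a chordal uniformizing map
`φ` of `D` (`ConformalEquiv.pullbackHull`):

* `measure_level_eq_zero_of_identity` — **`(∗)` forces `r` to be a non-atom**:
  `μ{dist(x₀, trace) = r} = 0`. (Test `(∗)` on the closed level set `L_r`: `μ'(L_r) = 0` because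
  `μ'`-a.e. curve is simple, lies in `cl D'` and meets `∂D'` only at `a`, `b` (Rohde–Schramm,
  `IsSLELaw.ae_simple`, `IsSLELaw.ae_endpoints`), whereas a curve of `L_r` inside `cl D'` touches
  the sphere `|z − x₀| = r ⊆ ∂D'` away from `a`, `b`; and `L_r ⊆ N_r`.)
* `identity_hullForm_of_identity` — `(∗)` in the tree's hull-subdomain vocabulary:
  `μ'(T) · μ{Γ ⊆ cl D'} = μ(T ∩ {Γ ⊆ cl D'})` (`ChordalFamily.IsHullRestriction` shape for the
  pair; `N_r = {Γ ⊆ cl D'}` `μ`-a.e., `rangeSubset_closure_carved_eq`).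
* `sleRestriction_canonical_of_identity` (registered helper) — **canonical-space form**: for any
  description `μ = P ∘ Γ⁻¹` of the SLE_κ law of `D` through a chordal uniformizing map `φ`
  (`Γ ω` the class of the compactified image of `γ_ω` under `φ`), the avoidance event
  `E = {γ ∩ A = ∅}` satisfies `P(E) = μ(N_r)` and `μ'(T) · P(E) = P(E ∩ Γ⁻¹ T)` for all Borel
  `T` — i.e. CONDITIONALLY ON AVOIDING `A`, the image of SLE_κ is the SLE_κ law of `D'`. On the
  full-measure event where `γ` is a simple trace (`κ ≤ 4`), `{γ ∩ A = ∅}` is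
  `{Γ ⊆ D' ∪ {a, b}}` (`disjoint_range_pullbackHull_iff`), which is squeezed between
  `{dist(x₀, trace) > r}` and `N_r`, equal `μ`-a.e. by the first bullet.

References: G. F. Lawler, O. Schramm, W. Werner, *Conformal restriction: the chordal case*,
J. Amer. Math. Soc. 16 (2003), §2 (hulls `𝒬*`), Prop. 3.3; S. Rohde, O. Schramm, *Basic properties
of SLE*, Ann. of Math. 161 (2005), Thm. 6.1. No named fact is used.
-/

noncomputable section

open MeasureTheory Filter Topology Set Metric
open scoped NNReal ENNReal
open Literature.Probability.RandomPlanarGeometry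
open Literature.Probability.Process (preWienerMeasure)
open UpperHalfPlane (upperHalfPlaneSet)

namespace Summit.CriticalPhenomena.SAWScalingLimit.Theorems.SubseqIdentification.BoundaryAreaLaw

/-! ### Measurability of the distance events -/

/-- `c ↦ dist(z, trace c)` is `1`-Lipschitz on curve classes. [folklore] -/
theorem lipschitzWith_infDist_range_rs5 (z : ℂ) :
    LipschitzWith 1 fun c : CurveClass ℂ ↦ infDist z c.range := by
  refine LipschitzWith.of_le_add fun c₁ c₂ ↦ ?_
  obtain ⟨γ₁, rfl⟩ := CurveClass.surjective_mk c₁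
  obtain ⟨γ₂, rfl⟩ := CurveClass.surjective_mk c₂
  simp only [CurveClass.range_mk, CurveClass.dist_mk_mk]
  have key : ∀ ⦃y⦄, y ∈ γ₂.range → infDist z γ₁.range - dist γ₁ γ₂ ≤ dist z y := by
    rintro y ⟨t, rfl⟩
    have h₁ := Curve.infDist_range_le γ₂ γ₁ t
    have h₂ := infDist_le_infDist_add_dist (s := γ₁.range) (x := z) (y := γ₂ t)
    rw [dist_comm γ₂ γ₁] at h₁
    linarith
  have h := (le_infDist γ₂.range_nonempty).2 key
  linarith

/-- The event `{r ≤ dist(x₀, trace)}` is closed, hence Borel. [folklore] -/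
theorem measurableSet_le_infDist_range (x₀ : ℂ) (r : ℝ) :
    MeasurableSet {c : CurveClass ℂ | r ≤ infDist x₀ c.range} :=
  (isClosed_le continuous_const (lipschitzWith_infDist_range_rs5 x₀).continuous).measurableSet

/-- The level event `{dist(x₀, trace) = r}` is closed, hence Borel. [folklore] -/
theorem measurableSet_infDist_range_eq (x₀ : ℂ) (r : ℝ) :
    MeasurableSet {c : CurveClass ℂ | infDist x₀ c.range = r} :=
  (isClosed_eq (lipschitzWith_infDist_range_rs5 x₀).continuous continuous_const).measurableSet

/-! ### `(∗)` forces `r` to be a non-atom of `dist(x₀, trace)` -/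

/-- **The carved SLE law does not charge the level set.** If `μ'` is the chordal SLE_κ law
(`0 < κ ≤ 4`) of a Dobrushin domain `D'` with carrier `D ∖ B̄(x₀, r)` and marked points at
distance `≥ ρ₀ > r` from `x₀`, then `μ'{dist(x₀, trace) = r} = 0`: `μ'`-a.e. curve is simple, lies
in `cl D'` and meets `∂D'` only at the marked points, but a curve in `cl D'` at distance exactly
`r` from `x₀` has a point on the sphere `|z − x₀| = r`, which is not in `D'`, hence is a boundary
point other than the marked ones. [cite: RohdeSchramm2005, Thm. 6.1] -/
theorem measure_level_eq_zero_carved {κ : ℝ≥0} (hκ0 : 0 < κ) (hκ4 : κ ≤ 4)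
    {D D' : DobrushinDomain} {μ' : Measure (CurveClass ℂ)} {x₀ : ℂ} {ρ₀ r : ℝ} (hrρ : r < ρ₀)
    (ha : ρ₀ ≤ dist x₀ (D.pt 0)) (hb : ρ₀ ≤ dist x₀ (D.pt 1))
    (hD' : D'.carrier = D.carrier \ closedBall x₀ r) (h0 : D'.pt 0 = D.pt 0)
    (h1 : D'.pt 1 = D.pt 1) (hμ' : IsSLELaw κ D' μ') :
    μ' {c : CurveClass ℂ | infDist x₀ c.range = r} = 0 := by
  have hgen : HasSLETrace κ := by
    obtain ⟨Γ', hΓ', -⟩ := hμ'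
    exact hΓ'.hasSLETrace
  have h₆ : ae_isSimpleTrace_sleTrace_of_le_four (κ := κ) :=
    fun _ h4 ↦ ae_isSimpleTrace_sleTrace_of_hasSLETrace hgen h4
  rw [measure_eq_zero_iff_ae_notMem]
  filter_upwards [hμ'.ae_simple h₆ CurveClass.measurableSet_simple_holds hκ0 hκ4,
    hμ'.ae_endpoints JordanDomain.mapsTo_boundaryExtension_holds] with c hs he hc
  obtain ⟨z, hz, hzd⟩ := c.isCompact_range.exists_infDist_eq_dist c.range_nonempty x₀
  have hdist : dist x₀ z = r := by rw [← hzd]; exact hc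
  have hzcl : z ∈ closure D'.carrier := he.2.2 hz
  have hzD' : z ∉ D'.carrier := by
    rw [hD']
    intro h
    exact h.2 (by rw [mem_closedBall, dist_comm, hdist])
  have hzfr : z ∈ frontier D'.carrier := by
    rw [frontier, D'.isOpen.interior_eq]
    exact ⟨hzcl, hzD'⟩
  have hzab := hs.2 ⟨hz, hzfr⟩
  rw [h0, h1] at hzab
  simp only [mem_insert_iff, mem_singleton_iff] at hzab
  rcases hzab with rfl | rfl
  · linarith
  · linarith

/-- **`(∗)` forces `r` to be a non-atom of `dist(x₀, trace)` under `μ`.** If the restriction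
identity `μ'(T) · μ(N_r) = μ(T ∩ N_r)` holds for all Borel `T` with `μ'` the chordal SLE_κ law
(`0 < κ ≤ 4`) of the carved domain, then `μ{dist(x₀, trace) = r} = 0` (test it on the level set,
which is `μ'`-null by `measure_level_eq_zero_carved` and contained in `N_r`). [folklore] -/
theorem measure_level_eq_zero_of_identity {κ : ℝ≥0} (hκ0 : 0 < κ) (hκ4 : κ ≤ 4)
    {D D' : DobrushinDomain} {μ μ' : Measure (CurveClass ℂ)} {x₀ : ℂ} {ρ₀ r : ℝ} (hrρ : r < ρ₀)
    (ha : ρ₀ ≤ dist x₀ (D.pt 0)) (hb : ρ₀ ≤ dist x₀ (D.pt 1))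
    (hD' : D'.carrier = D.carrier \ closedBall x₀ r) (h0 : D'.pt 0 = D.pt 0)
    (h1 : D'.pt 1 = D.pt 1) (hμ' : IsSLELaw κ D' μ')
    (hid : ∀ T : Set (CurveClass ℂ), MeasurableSet T →
      μ' T * μ {c | r ≤ infDist x₀ c.range} = μ (T ∩ {c | r ≤ infDist x₀ c.range})) :
    μ {c : CurveClass ℂ | infDist x₀ c.range = r} = 0 := by
  have h := hid _ (measurableSet_infDist_range_eq x₀ r)
  have hsub : ({c : CurveClass ℂ | infDist x₀ c.range = r} ∩ {c | r ≤ infDist x₀ c.range} :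
      Set (CurveClass ℂ)) = {c | infDist x₀ c.range = r} :=
    inter_eq_left.2 fun c hc ↦ (show infDist x₀ c.range = r from hc).symm.le
  rw [measure_level_eq_zero_carved hκ0 hκ4 hrρ ha hb hD' h0 h1 hμ', zero_mul, hsub] at h
  exact h.symm

/-! ### `(∗)` in hull-subdomain form -/

/-- **`(∗)` in the tree's hull-subdomain vocabulary.** Under the window hypotheses, if `μ` is the
chordal SLE_κ law of `D` (any `κ`) then `N_r = {Γ ⊆ cl D'}` `μ`-a.e.
(`rangeSubset_closure_carved_eq`, `IsSLELaw.ae_endpoints`), so `(∗)` reads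
`μ'(T) · μ{Γ ⊆ cl D'} = μ(T ∩ {Γ ⊆ cl D'})` — the shape of `ChordalFamily.IsHullRestriction`
for the pair `(D, D')`. [folklore] -/
theorem identity_hullForm_of_identity {κ : ℝ≥0} {D D' : DobrushinDomain}
    {μ μ' : Measure (CurveClass ℂ)} {x₀ : ℂ} {ρ₀ r : ℝ} (hr : 0 < r) (hrρ : r < ρ₀)
    (hwin : D.carrier ∩ ball x₀ ρ₀ = {z : ℂ | x₀.im < z.im} ∩ ball x₀ ρ₀)
    (hD' : D'.carrier = D.carrier \ closedBall x₀ r) (hμ : IsSLELaw κ D μ)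
    (hid : ∀ T : Set (CurveClass ℂ), MeasurableSet T →
      μ' T * μ {c | r ≤ infDist x₀ c.range} = μ (T ∩ {c | r ≤ infDist x₀ c.range}))
    {T : Set (CurveClass ℂ)} (hT : MeasurableSet T) :
    μ' T * μ (CurveClass.rangeSubset (closure D'.carrier)) =
      μ (T ∩ CurveClass.rangeSubset (closure D'.carrier)) := by
  have hV := rangeSubset_closure_carved_eq (D := D) (D' := D') hr hrρ hwin hD'
  have hae : ∀ᵐ c ∂μ, c ∈ CurveClass.rangeSubset (closure D.carrier) :=
    (hμ.ae_endpoints JordanDomain.mapsTo_boundaryExtension_holds).mono fun c hc ↦ hc.2.2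
  have hNV : ({c : CurveClass ℂ | r ≤ infDist x₀ c.range} : Set (CurveClass ℂ)) =ᵐ[μ]
      CurveClass.rangeSubset (closure D'.carrier) := by
    rw [hV]
    exact Filter.eventuallyEq_set.2 (hae.mono fun c hc ↦ ⟨fun h ↦ ⟨h, hc⟩, fun h ↦ h.1⟩)
  rw [← measure_congr hNV, ← measure_congr ((ae_eq_refl T).inter hNV)]
  exact hid T hT

/-! ### The canonical-space form -/

/-- **On the simple-trace event, avoiding the pulled-back hull means staying at distance `> r`,
up to the level set.** Let `γ` be a path in `ℍ ∪ {0}` from `0`, `c` its compactified image under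
`φ`; if the class of `c` lies in `cl D`, meets `∂D` only at `a`, `b`, stays at distance `≥ r` from
`x₀` but not at distance exactly `r`, then `γ ∩ A = ∅` for the pulled-back hull `A` of the carved
domain. [folklore] -/
theorem disjoint_pullbackHull_of_le_infDist {D D' : DobrushinDomain}
    {φ : ConformalEquiv upperHalfPlaneSet D.carrier} (hφ : D.IsChordalUniformizing φ)
    {x₀ : ℂ} {ρ₀ r : ℝ} (hrρ : r < ρ₀) (ha : ρ₀ ≤ dist x₀ (D.pt 0)) (hb : ρ₀ ≤ dist x₀ (D.pt 1))
    (hD' : D'.carrier = D.carrier \ closedBall x₀ r) (h0 : D'.pt 0 = D.pt 0)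
    (h1 : D'.pt 1 = D.pt 1) {γ : ℝ≥0 → ℂ} (hγ0 : γ 0 = 0) (hH : ∀ t, 0 < t → 0 < (γ t).im)
    {c : Curve ℂ} (hc : IsCompactifiedImage φ.boundaryExtension γ (D.pt 1) c)
    (hcl : c.range ⊆ closure D.carrier)
    (hfr : c.range ∩ frontier D.carrier ⊆ {D.pt 0, D.pt 1})
    (hN : r ≤ infDist x₀ c.range) (hL : infDist x₀ c.range ≠ r) :
    Disjoint (range γ) (φ.pullbackHull D') := by
  have hsub : D.IsHullSubdomain D' := isHullSubdomain_of_carved hrρ ha hb hD' h0 h1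
  refine (disjoint_range_pullbackHull_iff hφ hsub hγ0 hH hc).2 fun z hz ↦ ?_
  have hzcl := hcl hz
  rw [closure_eq_self_union_frontier] at hzcl
  rcases hzcl with hzD | hzfr
  · refine Or.inl ?_
    rw [hD']
    refine ⟨hzD, fun hzb ↦ ?_⟩
    rw [mem_closedBall, dist_comm] at hzb
    have hge : r ≤ dist x₀ z := (le_infDist c.range_nonempty).1 hN hz
    have hle : infDist x₀ c.range ≤ dist x₀ z := infDist_le_dist_of_mem hz
    exact hL (le_antisymm (hle.trans hzb) hN)
  · right
    rw [h0, h1]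
    exact hfr ⟨hz, hzfr⟩

/-- **RS5 transport — the canonical-space form of the restriction identity, for every
`0 < κ ≤ 4`.** In the setting of `stub_sleRestrictionRigidity` (flat window at `x₀`, carved
domain `D' = D ∖ B̄(x₀, r)` with the same marked points, `μ`, `μ'` the chordal SLE_κ laws of `D`,
`D'`), suppose the identity `μ'(T) · μ(N_r) = μ(T ∩ N_r)` holds for all Borel `T`. Let
`μ = P ∘ Γ⁻¹` be any description of `μ` through a chordal uniformizing map `φ` of `D` (`Γ ω` is
a.s. the class of the compactified image of the SLE_κ trace `γ_ω` under `φ`), and let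
`A = cl(ℍ ∖ φ⁻¹ D')` be the pulled-back hull (`∈ 𝒬*`, `IsStarHull.pullbackHull`). Then
`P[γ ∩ A = ∅] = μ(N_r)` and, for every Borel `T`, `μ'(T) · P[γ ∩ A = ∅] = P[γ ∩ A = ∅, Γ ∈ T]`:
conditionally on `{γ ∩ A = ∅}` the image curve has the SLE_κ law of `D'`. (The events
`{γ ∩ A = ∅}` and `Γ⁻¹ N_r` agree a.s.: one inclusion by `disjoint_range_pullbackHull_iff` and
`cl D' ⊆ ℂ ∖ B(x₀, r)`, the other by `disjoint_pullbackHull_of_le_infDist` off the level set,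
which is null by `measure_level_eq_zero_of_identity`.) This is the starting point of the
half-plane refutation of the identity for `κ ≠ 8/3` ([LSW] Prop. 5.3, Thm. 6.5).
[cite: LawlerSchrammWerner2003Restriction, §2 pp. 7–8 and Prop. 3.3 (transposed)] -/
theorem sleRestriction_canonical_of_identity :
    ∀ (κ : ℝ≥0), 0 < κ → κ ≤ 4 →
      ∀ (D D' : DobrushinDomain) (μ μ' : Measure (CurveClass ℂ)) (x₀ : ℂ) (ρ₀ r : ℝ),
        0 < r → r < ρ₀ →
        D.carrier ∩ Metric.ball x₀ ρ₀ = {z : ℂ | x₀.im < z.im} ∩ Metric.ball x₀ ρ₀ →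
        ρ₀ ≤ dist x₀ (D.pt 0) → ρ₀ ≤ dist x₀ (D.pt 1) →
        D'.carrier = D.carrier \ Metric.closedBall x₀ r → D'.pt 0 = D.pt 0 → D'.pt 1 = D.pt 1 →
        IsSLELaw κ D μ → IsSLELaw κ D' μ' →
        (∀ T : Set (CurveClass ℂ), MeasurableSet T →
            μ' T * μ {c | r ≤ Metric.infDist x₀ c.range} =
              μ (T ∩ {c | r ≤ Metric.infDist x₀ c.range})) →
        ∀ (Γ : (ℝ≥0 → ℝ) → CurveClass ℂ) (φ : ConformalEquiv upperHalfPlaneSet D.carrier),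
          D.IsChordalUniformizing φ → AEMeasurable Γ preWienerMeasure →
          (∀ᵐ ω ∂preWienerMeasure, ∃ c : Curve ℂ, Γ ω = CurveClass.mk c ∧
              IsCompactifiedImage φ.boundaryExtension (sleTrace κ ω) (D.pt 1) c) →
          μ = preWienerMeasure.map Γ →
          preWienerMeasure {ω | Disjoint (range (sleTrace κ ω)) (φ.pullbackHull D')} =
              μ {c | r ≤ Metric.infDist x₀ c.range} ∧
            ∀ T : Set (CurveClass ℂ), MeasurableSet T →
              μ' T * preWienerMeasure {ω | Disjoint (range (sleTrace κ ω)) (φ.pullbackHull D')} =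
                preWienerMeasure
                  ({ω | Disjoint (range (sleTrace κ ω)) (φ.pullbackHull D')} ∩ Γ ⁻¹' T) := by
  intro κ hκ0 hκ4 D D' μ μ' x₀ ρ₀ r _ hrρ _ ha hb hD' h0 h1 hμ hμ' hid Γ φ hφ hΓm hdesc hlaw
  have hsub : D.IsHullSubdomain D' := isHullSubdomain_of_carved hrρ ha hb hD' h0 h1
  -- trace facts at `κ`
  have hgen : HasSLETrace κ := by
    obtain ⟨Γ₀, hΓ₀, -⟩ := hμ
    exact hΓ₀.hasSLETrace
  have h₆ : ae_isSimpleTrace_sleTrace_of_le_four (κ := κ) :=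
    fun _ h4 ↦ ae_isSimpleTrace_sleTrace_of_hasSLETrace hgen h4
  -- the events
  set E : Set (ℝ≥0 → ℝ) := {ω | Disjoint (range (sleTrace κ ω)) (φ.pullbackHull D')} with hE
  set N : Set (CurveClass ℂ) := {c | r ≤ infDist x₀ c.range} with hN
  have hNm : MeasurableSet N := measurableSet_le_infDist_range x₀ r
  -- a.e. properties of `Γ ω` under `P`, transferred from `μ`
  have hlevel : μ {c : CurveClass ℂ | infDist x₀ c.range = r} = 0 :=
    measure_level_eq_zero_of_identity hκ0 hκ4 hrρ ha hb hD' h0 h1 hμ' hid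
  have haeμ : ∀ᵐ c ∂μ, (c ∈ CurveClass.simple ∧ c.range ∩ frontier D.carrier ⊆ {D.pt 0, D.pt 1}) ∧
      c.range ⊆ closure D.carrier ∧ infDist x₀ c.range ≠ r := by
    filter_upwards [hμ.ae_simple h₆ CurveClass.measurableSet_simple_holds hκ0 hκ4,
      hμ.ae_endpoints JordanDomain.mapsTo_boundaryExtension_holds,
      measure_eq_zero_iff_ae_notMem.1 hlevel] with c h1' h2' h3'
    exact ⟨h1', h2'.2.2, h3'⟩
  rw [hlaw] at haeμ
  have haeP := ae_of_ae_map hΓm haeμ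
  -- `E = Γ⁻¹ N` almost surely
  have hEN : E =ᵐ[preWienerMeasure] Γ ⁻¹' N := by
    refine Filter.eventuallyEq_set.2 ?_
    filter_upwards [hdesc, h₆ hκ0 hκ4, haeP] with ω ⟨c, hΓω, hc⟩ hsimple ⟨⟨_, hfr⟩, hcl, hL⟩
    rw [hΓω, CurveClass.range_mk] at hfr hcl hL
    constructor
    · intro hω
      have hR := subset_closure_of_subset_carrier_union
        ((disjoint_range_pullbackHull_iff hφ hsub (sleTrace_zero κ ω) hsimple.2 hc).1 hω)
      rw [hD'] at hR
      have hR' := hR.trans (closure_diff_closedBall_subset _ _ _)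
      change r ≤ infDist x₀ (Γ ω).range
      rw [hΓω, CurveClass.range_mk]
      exact (le_infDist c.range_nonempty).2 fun z hz ↦ by
        have h'' := (hR' hz).2
        rw [mem_ball, not_lt, dist_comm] at h''
        exact h''
    · intro hω
      change r ≤ infDist x₀ (Γ ω).range at hω
      rw [hΓω, CurveClass.range_mk] at hω
      exact disjoint_pullbackHull_of_le_infDist hφ hrρ ha hb hD' h0 h1 (sleTrace_zero κ ω)
        hsimple.2 hc hcl hfr hω hL
  have hPE : preWienerMeasure E = μ N := by
    rw [measure_congr hEN, hlaw, Measure.map_apply_of_aemeasurable hΓm hNm]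
  refine ⟨hPE, fun T hT ↦ ?_⟩
  rw [measure_congr (hEN.inter (ae_eq_refl (Γ ⁻¹' T))), hPE, hid T hT, hlaw,
    Measure.map_apply_of_aemeasurable hΓm (hT.inter hNm), preimage_inter, inter_comm]

end Summit.CriticalPhenomena.SAWScalingLimit.Theorems.SubseqIdentification.BoundaryAreaLaw

end
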